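import Summits.Langlands.Langlands.Theses.PhantomRMYoshida
import Summits.Langlands.Langlands.Theorems.PhantomRMYoshidaPhantomRMTransportCommutant
import Summits.Langlands.Langlands.Theorems.PhantomRMYoshidaPhantomRMTransportBlock
import Summits.Langlands.Langlands.Theorems.PhantomRMYoshidaPhantomRMTransportIrred
import Literature.NumberTheory.GaloisRepresentations.ModNCyclotomicCharacter

/-!
# Route `PhantomRMYoshida`: the transport lemma `PhantomRMTransport` (stmt-Langlands-13641)

Proof of `Summit.Langlands.Langlands.Theses.PhantomRMYoshida.PhantomRMTransport`: for `p` odd,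
`k ⊇ 𝔽_p` algebraically closed, `ρ̄ : Γ_ℚ → GL₄(𝔽_p)` irreducible, symplectic for an alternating
non-degenerate `J` with multiplier `ε̄⁻¹`, with commutant `𝔽_p[Φ] ≅ 𝔽_{p²}` (`Φ² = aΦ + b`,
`X² - aX - b` irreducible) and `Φ` `J`-self-adjoint, `ρ̄ ⊗ k` is conjugate to `σ ⊕ σ^(p)` with
`σ : Γ_ℚ → GL₂(k)` odd, irreducible, `det σ = ε̄⁻¹`, `σ ≄ σ^(p)`.

Assembly of the helper files `…PhantomRMTransport{Commutant, Frobenius, Eigen, EigenFrobenius,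
Sigma, Block, Descent, Irred}`: `λ ∈ k` a root of `X² - aX - b` with `λ^p ≠ λ`; `W = ker(Φ - λ)`
is a `Γ`-stable plane (the `ρ̄(g)` commute with `Φ`), `σ` is `ρ̄ ⊗ k` on a basis `e₀, e₁` of `W`;
the frame `(e₀, e₁, F e₀, F e₁)` exhibits `ρ̄ ⊗ k ≃ σ ⊕ σ^(p)`; `det σ = ε̄⁻¹` from the Gram matrix
of `J|_W` (`W ⊥ W'` as `Φ` is self-adjoint); oddness from `ε̄(c) = -1`
(`Literature.NumberTheory.GaloisRepresentations.modNCyclotomicCharacter_of_isComplexConjugation`);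
irreducibility and `σ ≄ σ^(p)` from the commutant computation over `k`. Continuity of `σ` holds
because `σ` factors through the continuous `ρ̄` into a discrete group.
-/

set_option linter.dupNamespace false
set_option autoImplicit false

namespace Summit.Langlands.Langlands.Theorems

open Matrix Module Literature.NumberTheory.GaloisRepresentations PhantomRMTransport

/-- Entrywise image of `c • M + d • 1`. [folklore] -/
private theorem map_smul_add_smul_one {p : ℕ} {k : Type} [Field k] (ι : ZMod p →+* k) {n : Type*}
    [Fintype n] [DecidableEq n] (c d : ZMod p) (M : Matrix n n (ZMod p)) :
    (c • M + d • (1 : Matrix n n (ZMod p))).map ι = ι c • M.map ι + ι d • (1 : Matrix n n k) := by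
  ext i j
  simp only [Matrix.map_apply, Matrix.add_apply, Matrix.smul_apply, smul_eq_mul, map_add, map_mul,
    Matrix.one_apply]
  split_ifs <;> simp

/-- Entrywise image of `c • M`. [folklore] -/
private theorem map_smul_matrix {p : ℕ} {k : Type} [Field k] (ι : ZMod p →+* k) {n : Type*}
    (c : ZMod p) (M : Matrix n n (ZMod p)) : (c • M).map ι = ι c • M.map ι := by
  ext i j
  simp

/-- **The transport lemma** (route `PhantomRMYoshida`, support item stmt-Langlands-13641).
[folklore] -/
theorem phantomRMTransport_proof : Summit.Langlands.Langlands.Theses.PhantomRMYoshida.PhantomRMTransport := by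
  intro p _ hp2 k _ _ _ _ _ ρb J Φ a b εb hJt hJdet hsymp hirr hΦ hcomm hΦJ hirred
  classical
  -- ### notation over `k`
  set ι : ZMod p →+* k := ZMod.castHom (dvd_refl p) k with hι
  letI : Algebra (ZMod p) k := ι.toAlgebra
  have hιalg : algebraMap (ZMod p) k = ι := rfl
  haveI : NeZero p := ⟨(Fact.out : p.Prime).ne_zero⟩
  set Γ := Field.absoluteGaloisGroup ℚ
  let Rk : Γ →* Matrix (Fin 4) (Fin 4) k :=
    (ι.mapMatrix : Matrix (Fin 4) (Fin 4) (ZMod p) →+* Matrix (Fin 4) (Fin 4) k).toMonoidHom.comp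
      ((Units.coeHom (Matrix (Fin 4) (Fin 4) (ZMod p))).comp ρb.toMonoidHom)
  have hRk : ∀ g, Rk g = ((ρb g : GL (Fin 4) (ZMod p)) : Matrix (Fin 4) (Fin 4) (ZMod p)).map ι :=
    fun g => rfl
  set Φk : Matrix (Fin 4) (Fin 4) k := Φ.map ι with hΦk
  set Jk : Matrix (Fin 4) (Fin 4) k := J.map ι with hJk
  have hΦkf : Φk.map (frobenius k p) = Φk := map_frobenius_map_ringHom ι Φ
  have hRkf : ∀ g, (Rk g).map (frobenius k p) = Rk g := fun g => by
    rw [hRk]; exact map_frobenius_map_ringHom ι _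
  have hak : frobenius k p (ι a) = ι a := frobenius_ringHom_apply ι a
  have hbk : frobenius k p (ι b) = ι b := frobenius_ringHom_apply ι b
  have hΦk2 : Φk * Φk = ι a • Φk + ι b • 1 := by
    have h1 := congrArg (fun M : Matrix (Fin 4) (Fin 4) (ZMod p) => M.map ι) hΦ
    simp only [Matrix.map_mul, map_smul_add_smul_one] at h1
    exact h1
  have hJkt : Jkᵀ = -Jk := by
    rw [hJk, ← Matrix.transpose_map, hJt]
    ext i j; simp
  have hJkdet : Jk.det ≠ 0 := by
    rw [hJk, ← RingHom.mapMatrix_apply, ← RingHom.map_det]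
    exact (map_ne_zero ι).2 hJdet
  have hΦJk : Φkᵀ * Jk = Jk * Φk := by
    rw [hΦk, hJk, ← Matrix.transpose_map, ← Matrix.map_mul, hΦJ, Matrix.map_mul]
  have hsympk : ∀ g, (Rk g)ᵀ * Jk * Rk g = ι (((εb g)⁻¹ : (ZMod p)ˣ) : ZMod p) • Jk := by
    intro g
    rw [hRk, hJk, ← Matrix.transpose_map, ← Matrix.map_mul, ← Matrix.map_mul, hsymp g,
      map_smul_matrix]
  have h2 : (2 : k) ≠ 0 := by
    intro h
    have h' : ((2 : ℕ) : k) = 0 := by exact_mod_cast h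
    rw [CharP.cast_eq_zero_iff k p 2] at h'
    exact hp2 ((Nat.prime_dvd_prime_iff_eq Fact.out Nat.prime_two).1 h')
  -- the commutant over `k`
  have hΦcomm : ∀ g, Φ * ((ρb g : GL (Fin 4) (ZMod p)) : Matrix (Fin 4) (Fin 4) (ZMod p)) =
      ((ρb g : GL (Fin 4) (ZMod p)) : Matrix (Fin 4) (Fin 4) (ZMod p)) * Φ :=
    (hcomm Φ).2 ⟨0, 1, by simp⟩
  have hRΦ : ∀ g, Rk g * Φk = Φk * Rk g := fun g => by
    rw [hRk, hΦk, ← Matrix.map_mul, ← hΦcomm g, Matrix.map_mul]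
  have hcommk : ∀ X : Matrix (Fin 4) (Fin 4) k, (∀ g, X * Rk g = Rk g * X) →
      ∃ c d : k, X = c • 1 + d • Φk := by
    intro X hX
    have := exists_eq_smul_one_add_smul_of_commute (K := ZMod p) (L := k)
      (fun g : Γ => ((ρb g : GL (Fin 4) (ZMod p)) : Matrix (Fin 4) (Fin 4) (ZMod p))) Φ
      (fun Y hY => (hcomm Y).1 hY) X (by simpa only [hιalg, ← hRk] using hX)
    simpa only [hιalg] using this
  -- ### the roots `λ`, `λ' = λ^p` and the eigenplane `W`
  obtain ⟨lam, hlam, hlamne⟩ := exists_root_pow_ne ι hirr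
  set lam' := lam ^ p with hlam'
  have h' : lam' * lam' = ι a * lam' + ι b := pow_root_of_root hak hbk hlam
  have hne : lam ≠ lam' := fun h => hlamne (h.symm)
  have hlam2 : lam' ^ p = lam := pow_pow_eq_of_root hak hbk hlam hlamne
  set W := End.eigenspace (Matrix.toLin' Φk) lam with hW
  have hW2 : finrank k W = 2 :=
    (finrank_eigenspace_eq_two hΦk2 hlam h' hne hΦkf rfl hlam2).1
  let bW := Module.finBasisOfFinrankEq k W hW2
  let e : Fin 2 → Fin 4 → k := fun j => (bW j : Fin 4 → k)
  have he : ∀ j, e j ∈ W := fun j => (bW j).2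
  have hli : LinearIndependent k e := bW.linearIndependent.map' W.subtype (Submodule.ker_subtype W)
  have hspan : W ≤ Submodule.span k (Set.range e) := by
    intro x hx
    have h1 := congrArg Subtype.val (bW.sum_repr ⟨x, hx⟩)
    rw [Submodule.coe_sum] at h1
    change _ = x at h1
    rw [← h1]
    exact Submodule.sum_mem _ fun j _ => by
      rw [Submodule.coe_smul]
      exact Submodule.smul_mem _ _ (Submodule.subset_span ⟨j, rfl⟩)
  have hspan' : W ≤ Submodule.span k {e 0, e 1} := by
    refine hspan.trans (Submodule.span_le.2 ?_)
    rintro _ ⟨j, rfl⟩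
    fin_cases j
    · exact Submodule.subset_span (Set.mem_insert _ _)
    · exact Submodule.subset_span (Set.mem_insert_of_mem _ rfl)
  have hWstab : ∀ g, ∀ v ∈ W, Rk g *ᵥ v ∈ W := fun g v hv =>
    mulVec_mem_eigenspace_of_commute (hRΦ g) hv
  -- ### the matrices `S g` and the homomorphism `σ₀`
  obtain ⟨S, hS⟩ := exists_matrix_of_mapsTo (⇑Rk) W e he hspan hWstab
  obtain ⟨σ₀, hσ₀⟩ := exists_hom_val_eq hli hS
  have hβ : e 0 ⬝ᵥ (Jk *ᵥ e 1) ≠ 0 :=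
    dotProduct_mulVec_ne_zero_of_span hΦk2 hlam h' hne hΦJk hJkt h2 hJkdet (hli.ne_zero 0) (he 0)
      hspan'
  have hdet : ∀ g, (S g).det = ι (((εb g)⁻¹ : (ZMod p)ˣ) : ZMod p) := fun g =>
    det_matrix_eq hJkt h2 hS hβ (hsympk g)
  -- ### the block frame
  obtain ⟨G, hGunit, hRG, hΦG⟩ := exists_block_frame hΦk2 hlam h' hne hΦkf rfl hRkf he hli hS
  have hEnd : ∀ A : Matrix (Fin 2) (Fin 2) k, (∀ g, A * S g = S g * A) → ∃ c : k, A = c • 1 :=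
    exists_eq_smul_one_of_commute_matrix (finSumFinEquiv : Fin 2 ⊕ Fin 2 ≃ Fin 4) (⇑Rk) hcommk
      hGunit hRG hΦG
  have hirrσ := isIrreducible_of_commutant ι ρb.toMonoidHom hirred hRk hΦkf hlamne
    (by rw [← hlam']; exact hlam2) he hli hspan hS hEnd σ₀ hσ₀
  have hnconj := not_exists_conj_frobenius (finSumFinEquiv : Fin 2 ⊕ Fin 2 ≃ Fin 4) (⇑Rk) hcommk
    hGunit hRG hΦG
  -- ### continuity: `σ₀` factors through `ρ̄`
  have hfactor : ∀ x y, ρb x = ρb y → σ₀ x = σ₀ y := by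
    intro x y hxy
    have hRxy : Rk x = Rk y := by rw [hRk, hRk, hxy]
    refine Units.ext ?_
    rw [hσ₀, hσ₀]
    have hcol : ∀ j, (fun i => S x i j) = fun i => S y i j := fun j =>
      eq_of_sum_smul_eq hli (by rw [← hS x j, ← hS y j, hRxy])
    ext i j
    exact congrFun (hcol j) i
  let fσ : GL (Fin 4) (ZMod p) → GL (Fin 2) k := fun u =>
    if h : ∃ x, ρb x = u then σ₀ h.choose else 1
  have hfσ : ∀ x, σ₀ x = fσ (ρb x) := by
    intro x
    have h : ∃ y, ρb y = ρb x := ⟨x, rfl⟩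
    simp only [fσ, dif_pos h]
    exact hfactor _ _ h.choose_spec.symm
  have hcont : Continuous σ₀ := by
    have : (σ₀ : Γ → GL (Fin 2) k) = fσ ∘ ρb := funext hfσ
    rw [this]
    exact continuous_of_discreteTopology.comp ρb.continuous
  let σ : FramedGaloisRep ℚ k 2 := ⟨σ₀, hcont⟩
  have hσval : ∀ x, ((σ x : GL (Fin 2) k) : Matrix (Fin 2) (Fin 2) k) = S x := hσ₀
  -- ### conclusion
  refine ⟨σ, hGunit.unit, ?_, hirrσ, ?_, ?_, ?_⟩
  · -- odd
    intro φ c hc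
    refine Units.ext ?_
    rw [Matrix.GeneralLinearGroup.val_det_apply, hσval, hdet, Units.val_neg, Units.val_one]
    have hε : ((εb c : (ZMod p)ˣ) : ZMod p) = -1 :=
      modNCyclotomicCharacter_of_isComplexConjugation (K := ℚ) (N := p) hc
    have hε' : (εb c : (ZMod p)ˣ) = -1 := Units.ext (by rw [hε, Units.val_neg, Units.val_one])
    rw [hε', inv_neg_one, Units.val_neg, Units.val_one, map_neg, map_one]
  · -- determinant
    intro x
    refine Units.ext ?_
    change ((Matrix.GeneralLinearGroup.det (σ x) : kˣ) : k) = _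
    rw [Matrix.GeneralLinearGroup.val_det_apply, hσval, hdet, Units.val_inv_eq_inv_val, map_inv₀,
      Units.val_inv_eq_inv_val, Units.coe_map]
    rfl
  · -- `σ ≄ σ^(p)`
    rintro ⟨h, hh⟩
    refine hnconj ⟨h, fun x => ?_⟩
    have h1 := congrArg (fun u : GL (Fin 2) k => ((u * h : GL (Fin 2) k) : Matrix (Fin 2) (Fin 2) k)) (hh x)
    simp only [inv_mul_cancel_right, Units.val_mul] at h1
    have h2 : ((FramedRep.baseChange (frobenius k p) continuous_of_discreteTopology σ x :
        GL (Fin 2) k) : Matrix (Fin 2) (Fin 2) k) = (S x).map (frobenius k p) := by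
      rw [FramedRep.baseChange_apply, ← hσval]
      rfl
    rw [hσval, h2] at h1
    exact h1
  · -- block form
    intro x
    have h1 : ((hGunit.unit⁻¹ : GL (Fin 4) k) : Matrix (Fin 4) (Fin 4) k) * G = 1 :=
      Units.inv_mul hGunit.unit
    rw [Units.val_mul, Units.val_mul, Matrix.mul_assoc]
    change ((hGunit.unit⁻¹ : GL (Fin 4) k) : Matrix (Fin 4) (Fin 4) k) * (Rk x * G) = _
    rw [hRG x, ← Matrix.mul_assoc, h1, Matrix.one_mul, ← hσval]
    rfl

end Summit.Langlands.Langlands.Theorems
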